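import Mathlib.CategoryTheory.Galois.Basic
import Mathlib.CategoryTheory.Galois.Topology
import Mathlib.CategoryTheory.Limits.ExactFunctor
import Mathlib.CategoryTheory.Comma.Over.Pullback
import Mathlib.CategoryTheory.Whiskering
import Mathlib.GroupTheory.Commensurable
import Mathlib.Topology.Algebra.OpenSubgroup
import Literature.AlgebraicGeometry.Frobenioids.Categories
import Literature.AnabelianGeometry.AbsoluteAnabelian.ProfiniteTerminology
import HarnessLib

/-!
# Anabelioids: the dictionary over Mathlib's Galois categories ([GeoAn] §1.1–1.2; [SemiAnbd] §0)

Mochizuki, *The geometry of anabelioids*, Publ. RIMS **40** (2004) 819–881, §1.1 "The Notion of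
an Anabelioid" and §1.2 "Finite Étale Morphisms", author's manuscript pp. 9–24
[cite: MochizukiGeoAn2004, §1.1-1.2 pp.9-24], together with the paragraph "Topological Groups" of
Mochizuki, *Semi-graphs of anabelioids*, Publ. RIMS **42** (2006), §0 p. 5
[cite: MochizukiSemiAnbd2006, §0 p.5].  This is the thin DEFINE layer every anabelian file of the
tree is typed over.  The dictionary (nothing of Mathlib is re-declared):

* connected anabelioid ([GeoAn] Def. 1.1.1; Remark 1.1.1.1 "the same as a Galois category") =
  Mathlib `GaloisCategory X`;
* `B(G)`, finite sets with continuous `G`-action = the tree's `Frobenioids.BCat G`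
  (= Mathlib `ContAction FintypeCat G`); that it is a connected anabelioid for profinite `G` is
  the named fact `bCat_galoisCategory` below ([GeoAn] §1.1 p. 9);
* a morphism `φ : X → Y` of connected anabelioids = an exact functor `φ^* : Y ⥤ X`
  ([GeoAn] Def. 1.1.2 (i)) = an object of Mathlib's `Y ⥤ₑ X`; the 2-morphisms are the morphisms
  of that category, so "the category of connected anabelioids is a 2-category" (Remark 1.1.2.1)
  is built in;
* a basepoint `β : Ens_f → X` (Def. 1.1.2 (ii)) = a fibre functor `F : X ⥤ FintypeCat`
  (Mathlib `FiberFunctor F`), and `π₁(X, β) := Aut(β)` = Mathlib's topological group `Aut F`;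
* `Z_G(H)`, `N_G(H)`, `C_G(H)` ([SemiAnbd] §0 p. 5) = Mathlib `Subgroup.centralizer`,
  `Subgroup.normalizer`, `Subgroup.Commensurable.commensurator`; *commensurably terminal* and
  *relatively slim homomorphism* ([GeoAn] Def. 1.2.9 (i)) = the cell's shared
  `AbsoluteAnabelian.ProfiniteTerminology` (`IsCommensurablyTerminal`, `IsRelativelySlim`), of which
  the names here are abbreviations; slim profinite group ([GeoAn] Def. 1.2.4 (i)) = the tree's
  `Frobenioids.IsSlimGroup`; rigid functor / slim category = `Frobenioids.IsRigidFunctor` /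
  `Frobenioids.IsSlim`.

New here: the homomorphism `π₁(X, β) → π₁(Y, φ ∘ β)` induced by a morphism; `π₁`-monomorphisms /
`π₁`-epimorphisms (Def. 1.1.7, 1.1.12, in the group-theoretic form [SemiAnbd] §2 pp. 22, 25 uses);
the image anabelioid `I_φ` (Def. 1.1.7 (i)); finite étale morphisms and coverings (Def. 1.2.2,
1.2.3); slim anabelioids and rigid morphisms (Def. 1.2.4); relatively slim morphisms (Def. 1.2.9
(ii)); the printed claims Cor. 1.1.6, "`I_φ` is a connected anabelioid" with its factorisation
(p. 14: `image_factorization` = injection half, `image_factorization_surjective` = surjection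
half), Remark 1.2.2.1, the three further assertions of Remark
1.2.9.1, and "[B(G)] is slim iff `Z_G(H) = {1}` for every open `H`" ([SemiAnbd] §0 p. 6) as NAMED
FACTS; the first assertion of Remark 1.2.9.1 and `H, N_G(H) ⊆ C_G(H)` PROVED.

Deliberately NOT here: not-necessarily-connected anabelioids as finite products (Def. 1.1.8–1.1.11;
the tree works componentwise), Prop. 1.1.4 (outer homomorphisms ↔ morphisms), pro-anabelioids and
universal coverings (Def. 1.2.6–Prop. 1.2.8), cores (§2 ff.).
-/

namespace Literature.AnabelianGeometry.Anabelioids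

open CategoryTheory CategoryTheory.Limits CategoryTheory.PreGaloisCategory
open Literature.AlgebraicGeometry.Frobenioids (IsSlimGroup BCat IsRigidFunctor)
open scoped FintypeCatDiscrete Pointwise

universe w v₁ v₂ v₃ u₁ u₂ u₃ u

/-! ### Topological groups ([SemiAnbd] §0 p. 5) -/

section TopologicalGroups

variable {G : Type u} [Group G]

/-- `H ⊆ G` is *commensurably terminal* if it equals its commensurator `C_G(H)`
([SemiAnbd] §0 p. 5; `C_G(H)` is Mathlib's `Subgroup.Commensurable.commensurator`) — the cell's
shared `AbsoluteAnabelian.IsCommensurablyTerminal`. [cite: MochizukiSemiAnbd2006, §0 p.5] -/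
abbrev IsCommensurablyTerminal (H : Subgroup G) : Prop := AbsoluteAnabelian.IsCommensurablyTerminal H

/-- "we have inclusions `H, Z_G(H) ⊆ N_G(H) ⊆ C_G(H)`" ([SemiAnbd] §0 p. 5): the part
`N_G(H) ⊆ C_G(H)`. [cite: MochizukiSemiAnbd2006, §0 p.5] -/
theorem normalizer_le_commensurator (H : Subgroup G) :
    Subgroup.normalizer (H : Set G) ≤ Subgroup.Commensurable.commensurator H := by
  intro g hg
  rw [Subgroup.Commensurable.commensurator_mem_iff]
  have h1 : ConjAct.toConjAct g • H = H := by
    ext x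
    rw [Subgroup.mem_pointwise_smul_iff_inv_smul_mem, ConjAct.smul_def]
    rw [Subgroup.mem_set_normalizer_iff''] at hg
    simp only [map_inv, ConjAct.ofConjAct_toConjAct, inv_inv]
    exact (hg x).symm
  rw [h1]

/-- "we have inclusions `H, Z_G(H) ⊆ N_G(H) ⊆ C_G(H)`" ([SemiAnbd] §0 p. 5): the part
`H ⊆ C_G(H)`. [cite: MochizukiSemiAnbd2006, §0 p.5] -/
theorem le_commensurator (H : Subgroup G) : H ≤ Subgroup.Commensurable.commensurator H :=
  Subgroup.le_normalizer.trans (normalizer_le_commensurator H)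

/-- A continuous homomorphism of (Hausdorff) topological groups `G → H` is *relatively slim* if the
centralizer in `H` of the image of every open subgroup of `G` is trivial ([GeoAn] Def. 1.2.9 (i);
stated for an abstract homomorphism, continuity being carried by the user) — the cell's shared
`AbsoluteAnabelian.IsRelativelySlim`. [cite: MochizukiGeoAn2004, Def. 1.2.9(i) p.24] -/
abbrev IsRelativelySlimHom {G : Type u₁} [Group G] [TopologicalSpace G] {H : Type u₂} [Group H]
    [TopologicalSpace H] (f : G →* H) : Prop :=
  AbsoluteAnabelian.IsRelativelySlim f

end TopologicalGroups

/-! ### Connected anabelioids, `B(G)`, morphisms, basepoints ([GeoAn] §1.1 pp. 9–10) -/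

/-- NAMED FACT ([GeoAn] §1.1 p. 9: "`B(G)` … forms a rather special kind of topos called a Galois
category"; [SemiAnbd] §0 p. 6: "Thus, `B(G)` is a Galois category, or, in the terminology of
[Mzk4], a connected anabelioid"): for a profinite group `G`, finite sets with continuous `G`-action
form a Galois category.  Mathlib proves this for discrete `G` (`Action FintypeCat G`); the
continuous case is not yet in Mathlib or the tree. [cite: MochizukiGeoAn2004, §1.1 p.9] -/
def bCat_galoisCategory : Prop :=
  ∀ (G : Type) [Group G] [TopologicalSpace G] [IsTopologicalGroup G] [CompactSpace G]
    [T2Space G] [TotallyDisconnectedSpace G], GaloisCategory (BCat G)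

section Morphisms

variable (X : Type u₁) [Category.{v₁} X] (Y : Type u₂) [Category.{v₂} Y] (Z : Type u₃) [Category.{v₃} Z]

/-- A *morphism of (connected) anabelioids* `φ : X → Y` IS an exact functor `φ^* : Y ⥤ X` in the
opposite direction ([GeoAn] Def. 1.1.2 (i), Def. 1.1.10 (ii)); we use Mathlib's category
`Y ⥤ₑ X` of exact functors, whose morphisms are the 2-morphisms of Remark 1.1.2.1.  An
*isomorphism* of anabelioids is a morphism whose functor is an equivalence (Remark 1.1.2.3).
[cite: MochizukiGeoAn2004, Def. 1.1.2(i) p.10] -/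
abbrev Hom : Type max u₁ u₂ v₁ v₂ := Y ⥤ₑ X

variable {X Y Z}

/-- The pull-back functor `φ^* : Y ⥤ X` underlying a morphism `φ : X → Y`.
[cite: MochizukiGeoAn2004, Def. 1.1.2(i) p.10] -/
abbrev Hom.pullback (φ : Hom X Y) : Y ⥤ X := φ.obj

/-- `φ` is an *isomorphism of anabelioids*: `φ^*` is an equivalence of categories
([GeoAn] Def. 1.1.2 (i), Remark 1.1.2.3). [cite: MochizukiGeoAn2004, Def. 1.1.2(i) p.10] -/
def Hom.IsIsomorphism (φ : Hom X Y) : Prop := φ.pullback.IsEquivalence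

variable (X) in
/-- The identity morphism of an anabelioid (identity functor, which is exact).
[cite: MochizukiGeoAn2004, Def. 1.1.2(i) p.10] -/
noncomputable def Hom.id : Hom X X := ExactFunctor.of (𝟭 X)

/-- Composition of morphisms of anabelioids: `(ψ ∘ φ)^* = φ^* ∘ ψ^*` ("requires special care",
Remark 1.1.2.1 — it is strictly associative here since functor composition is).
[cite: MochizukiGeoAn2004, Def. 1.1.2(i) p.10] -/
noncomputable def Hom.comp (φ : Hom X Y) (ψ : Hom Y Z) : Hom X Z :=
  ((ExactFunctor.whiskeringLeft Z Y X).obj ψ).obj φ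

/-- The functor underlying a composite is the composite of the underlying functors.
[cite: MochizukiGeoAn2004, Def. 1.1.2(i) p.10] -/
theorem Hom.comp_pullback (φ : Hom X Y) (ψ : Hom Y Z) :
    (φ.comp ψ).pullback = ψ.pullback ⋙ φ.pullback := rfl

/-- The homomorphism `π₁(X, β) → π₁(Y, φ ∘ β)` induced by a morphism `φ : X → Y` on fundamental
groups, for the basepoint `β` of `X` given by a functor `F : X ⥤ FintypeCat` and the induced
basepoint `φ ∘ β` of `Y` (functor `φ^* ⋙ F`): an automorphism of `F` is whiskered with `φ^*`
([GeoAn] Def. 1.1.2 (ii), proof of Prop. 1.1.4 p. 11: "φ induces a morphism `Aut(β) → Aut(γ)`").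
Stated for an arbitrary functor `P = φ^*`. [cite: MochizukiGeoAn2004, Def. 1.1.2(ii) p.10] -/
def pi1Map (P : Y ⥤ X) (F : X ⥤ FintypeCat.{w}) : Aut F →* Aut (P ⋙ F) :=
  ((Functor.whiskeringLeft Y X FintypeCat.{w}).obj P).mapAut F

/-- Components of the induced automorphism: `(π₁(φ) σ)_B = σ_{φ^* B}`.
[cite: MochizukiGeoAn2004, Def. 1.1.2(ii) p.10] -/
@[simp] theorem pi1Map_hom_app (P : Y ⥤ X) (F : X ⥤ FintypeCat.{w}) (σ : Aut F) (B : Y) :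
    (pi1Map P F σ).hom.app B = σ.hom.app (P.obj B) := rfl

end Morphisms

/-! ### `π₁`-monomorphisms, `π₁`-epimorphisms, the image anabelioid ([GeoAn] pp. 13–16) -/

section Image

variable {X : Type u₁} [Category.{v₁} X] {Y : Type u₂} [Category.{v₂} Y]

/-- The objects of the *image* `I_φ ⊆ X` of a morphism `φ : X → Y`: the subquotients (quotients of
subobjects) of objects in the essential image of `φ^*` ([GeoAn] p. 14, Def. 1.1.7 (i)); stated for
the functor `P = φ^*`. [cite: MochizukiGeoAn2004, Def. 1.1.7(i) p.14] -/
def imageObj (P : Y ⥤ X) : ObjectProperty X := fun A =>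
  ∃ (B : Y) (S : X) (i : S ⟶ P.obj B) (q : S ⟶ A), Mono i ∧ Epi q

/-- The *image anabelioid* `I_φ` of `φ : X → Y`: the full subcategory of `X` on the subquotients of
objects `φ^* B` ([GeoAn] Def. 1.1.7 (i)). [cite: MochizukiGeoAn2004, Def. 1.1.7(i) p.14] -/
abbrev Image (P : Y ⥤ X) := (imageObj P).FullSubcategory

variable [GaloisCategory X] [GaloisCategory Y]

/-- `φ : X → Y` is a *`π₁`-monomorphism*: it induces an injective homomorphism on fundamental
groups, for every basepoint ([GeoAn] Def. 1.1.7 (ii), 1.1.12, in the form [SemiAnbd] §2 p. 22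
uses: "i.e., induce injective homomorphisms on associated fundamental groups"); stated for the
functor `P = φ^*`. [cite: MochizukiGeoAn2004, Def. 1.1.7(ii) p.14] -/
def IsPi1Mono (P : Y ⥤ X) : Prop :=
  ∀ (F : X ⥤ FintypeCat.{v₁}) [FiberFunctor F], Function.Injective (pi1Map P F)

/-- `φ : X → Y` is a *`π₁`-epimorphism*: it induces a surjective homomorphism on fundamental
groups, for every basepoint ([GeoAn] Def. 1.1.7 (ii), 1.1.12; [SemiAnbd] §2 p. 25 "i.e., induces a
surjective homomorphism on associated fundamental groups"); stated for `P = φ^*`.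
[cite: MochizukiGeoAn2004, Def. 1.1.7(ii) p.14] -/
def IsPi1Epi (P : Y ⥤ X) : Prop :=
  ∀ (F : X ⥤ FintypeCat.{v₁}) [FiberFunctor F], Function.Surjective (pi1Map P F)

/-- NAMED FACT ([GeoAn] p. 14): "One verifies immediately that `I_φ` is a connected anabelioid",
for an exact `φ^*` between connected anabelioids. [cite: MochizukiGeoAn2004, §1.1 p.14] -/
def image_galoisCategory : Prop :=
  ∀ (X : Type u₁) [Category.{v₁} X] (Y : Type u₂) [Category.{v₂} Y] [GaloisCategory X]
    [GaloisCategory Y] (φ : Hom X Y), GaloisCategory (Image φ.pullback)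

/-- NAMED FACT ([GeoAn] p. 14): the morphism `φ : X → Y` factors as `X → I_φ → Y` and "the induced
morphisms of fundamental groups `π₁(X) ↠ π₁(I_φ) ↪ π₁(Y)` are a surjection followed by an
injection" — rendered (injection half): `π₁(X) → π₁(Y)` and `π₁(X) → π₁(I_φ) = Aut(ι ⋙ β)`
(`ι : I_φ ⥤ X` the inclusion) have the same kernel; the surjection half is the separate fact
`image_factorization_surjective`. [cite: MochizukiGeoAn2004, §1.1 p.14] -/
def image_factorization : Prop :=
  ∀ (X : Type u₁) [Category.{v₁} X] (Y : Type u₂) [Category.{v₂} Y] [GaloisCategory X]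
    [GaloisCategory Y] (φ : Hom X Y) (F : X ⥤ FintypeCat.{v₁}) [FiberFunctor F],
    (pi1Map φ.pullback F).ker = (pi1Map (imageObj φ.pullback).ι F).ker

/-- NAMED FACT ([GeoAn] p. 14), surjection half of the factorisation `π₁(X) ↠ π₁(I_φ) ↪ π₁(Y)`:
`π₁(X, β) → π₁(I_φ, ι ∘ β)` is surjective. [cite: MochizukiGeoAn2004, §1.1 p.14] -/
def image_factorization_surjective : Prop :=
  ∀ (X : Type u₁) [Category.{v₁} X] (Y : Type u₂) [Category.{v₂} Y] [GaloisCategory X]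
    [GaloisCategory Y] (φ : Hom X Y) (F : X ⥤ FintypeCat.{v₁}) [FiberFunctor F],
    Function.Surjective (pi1Map (imageObj φ.pullback).ι F)

/-- NAMED FACT, [GeoAn] Corollary 1.1.6 (Automorphisms of an Arrow Between Connected Anabelioids):
"The set of automorphisms `Aut(X → Y)` of a 1-arrow between connected anabelioids is in natural
bijective correspondence with the centralizer in the fundamental group of `Y` of the image of the
fundamental group of `X`" — here with the basepoints `β` of `X` and `φ ∘ β` of `Y`.
[cite: MochizukiGeoAn2004, Cor. 1.1.6 p.14] -/
def automorphisms_of_arrow : Prop :=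
  ∀ (X : Type u₁) [Category.{v₁} X] (Y : Type u₂) [Category.{v₂} Y] [GaloisCategory X]
    [GaloisCategory Y] (φ : Hom X Y) (F : X ⥤ FintypeCat.{v₁}) [FiberFunctor F],
    Nonempty ((φ ≅ φ) ≃ Subgroup.centralizer (Set.range (pi1Map φ.pullback F)))

end Image

/-! ### Finite étale morphisms ([GeoAn] §1.2 pp. 16–18) -/

section FiniteEtale

variable {X : Type u₁} [Category.{v₁} X] {Y : Type u₂} [Category.{v₂} Y]

/-- A morphism of anabelioids `φ : Y → X` is *finite étale* if it factors as an isomorphism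
`α : Y ⥲ X_S` followed by `i_S : X_S → X` for some object `S` of `X`, where `X_S` is the category
of objects over `S` and `i_S^*` is "taking the product with `S`" ([GeoAn] §1.2 p. 16, Def. 1.2.2
(i)); rendered: `φ^* ≅ i_S^* ⋙ α^*` with `i_S^* = Over.star S` and `α^* : X_S ⥤ Y` an
equivalence.  Stated for the functor `P = φ^*`. [cite: MochizukiGeoAn2004, Def. 1.2.2(i) p.17] -/
def IsFiniteEtale [HasBinaryProducts X] (P : X ⥤ Y) : Prop :=
  ∃ (S : X) (α : Over S ⥤ Y), α.IsEquivalence ∧ Nonempty (P ≅ Over.star S ⋙ α)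

/-- A finite étale morphism `φ : Y → X` to a *connected* anabelioid `X` is a *covering* if the
induced map on connected components is surjective ([GeoAn] Def. 1.2.3), i.e. (the target being
connected) if `Y` is nonempty: rendered as "`φ^*` does not send the terminal object to an initial
object". [cite: MochizukiGeoAn2004, Def. 1.2.3 p.18] -/
def IsFiniteEtaleCovering [HasBinaryProducts X] [HasTerminal X] (P : X ⥤ Y) : Prop :=
  IsFiniteEtale P ∧ IsEmpty (IsInitial (P.obj (⊤_ X)))

/-- NAMED FACT, [GeoAn] Remark 1.2.2.1: "the morphism `B(H) → B(G)` induced by a continuous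
homomorphism `φ : H → G` is finite étale if and only if `φ` is an injection onto an open subgroup
of `G`" (profinite `G`, `H`; the functor is restriction of the action along `φ`; the instance
`HasBinaryProducts (B(G))`, a consequence of `bCat_galoisCategory`, is taken as a hypothesis so
that `IsFiniteEtale` can be stated). [cite: MochizukiGeoAn2004, Rem. 1.2.2.1 p.17] -/
def bCat_res_isFiniteEtale_iff : Prop :=
  ∀ (G H : Type) [Group G] [TopologicalSpace G] [IsTopologicalGroup G] [CompactSpace G]
    [T2Space G] [TotallyDisconnectedSpace G] [Group H] [TopologicalSpace H] [IsTopologicalGroup H]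
    [CompactSpace H] [T2Space H] [TotallyDisconnectedSpace H] (φ : H →ₜ* G)
    [HasBinaryProducts (BCat G)],
    IsFiniteEtale (ContAction.res FintypeCat φ) ↔
      Function.Injective φ ∧ IsOpen (Set.range φ)

end FiniteEtale

/-! ### Slimness ([GeoAn] Def. 1.2.4, 1.2.9; [SemiAnbd] §0 p. 6) -/

section Slim

variable {X : Type u₁} [Category.{v₁} X] {Y : Type u₂} [Category.{v₂} Y]

variable (X) in
/-- A connected anabelioid is *slim* if its fundamental group is slim ([GeoAn] Def. 1.2.4 (ii)),
for every basepoint (all fundamental groups being isomorphic).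
[cite: MochizukiGeoAn2004, Def. 1.2.4(ii) p.18] -/
@[mk_iff] structure IsSlim [GaloisCategory X] : Prop where
  /-- `π₁(X, β)` is slim for every basepoint `β` -/
  isSlimGroup : ∀ (F : X ⥤ FintypeCat.{v₁}) [FiberFunctor F], IsSlimGroup (Aut F)

/-- A morphism of anabelioids is *rigid* if its pull-back functor is rigid, i.e. has no nontrivial
automorphisms ([GeoAn] Def. 1.2.4 (iii); rigid functor = the tree's `IsRigidFunctor`).
[cite: MochizukiGeoAn2004, Def. 1.2.4(iii) p.18] -/
def Hom.IsRigid (φ : Hom X Y) : Prop := IsRigidFunctor φ.pullback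

/-- A morphism `φ : U → V` of connected anabelioids is *relatively slim* if the induced homomorphism
of fundamental groups is relatively slim ([GeoAn] Def. 1.2.9 (ii)), for every basepoint of `U`;
stated for the functor `P = φ^*`. [cite: MochizukiGeoAn2004, Def. 1.2.9(ii) p.24] -/
def IsRelativelySlim [GaloisCategory X] [GaloisCategory Y] (P : Y ⥤ X) : Prop :=
  ∀ (F : X ⥤ FintypeCat.{v₁}) [FiberFunctor F], IsRelativelySlimHom (pi1Map P F)

/-- [GeoAn] Remark 1.2.9.1, first assertion: "`X` is slim if and only if the identity morphism
`X → X` is relatively slim" — PROVED. [cite: MochizukiGeoAn2004, Rem. 1.2.9.1 p.24] -/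
theorem isSlim_iff_isRelativelySlim_id [GaloisCategory X] : IsSlim X ↔ IsRelativelySlim (𝟭 X) := by
  have hid : ∀ (F : X ⥤ FintypeCat.{v₁}) (τ : Aut F), pi1Map (𝟭 X) F τ = τ := fun F τ => by ext; rfl
  have himg : ∀ (F : X ⥤ FintypeCat.{v₁}) (U : Subgroup (Aut F)),
      (pi1Map (𝟭 X) F) '' (U : Set (Aut F)) = (U : Set (Aut F)) := fun F U => by
    ext σ; constructor
    · rintro ⟨τ, hτ, rfl⟩; rw [hid]; exact hτ
    · intro hσ; exact ⟨σ, hσ, hid F σ⟩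
  constructor
  · intro h F _
    refine ⟨fun U hU => ?_⟩
    rw [himg]
    exact (h.isSlimGroup F).centralizer_eq_bot U hU
  · intro h
    refine ⟨fun F _ => ⟨fun U hU => ?_⟩⟩
    have hs := (h F).centralizer_eq_bot U hU
    rw [himg] at hs
    exact hs

/-- NAMED FACT, [GeoAn] Remark 1.2.9.1, second assertion: "if `U → V` is relatively slim, then the
arrow `U → V` is rigid [i.e., has no nontrivial automorphisms — cf. Corollary 1.1.6]" (stated for
the pull-back functor `P = φ^*`). [cite: MochizukiGeoAn2004, Rem. 1.2.9.1 p.24] -/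
def isRigid_of_isRelativelySlim : Prop :=
  ∀ (X : Type u₁) [Category.{v₁} X] (Y : Type u₂) [Category.{v₂} Y] [GaloisCategory X]
    [GaloisCategory Y] (φ : Hom X Y), IsRelativelySlim φ.pullback → φ.IsRigid

/-- NAMED FACT, [GeoAn] Remark 1.2.9.1, third assertion: "If `U → V` is a relatively slim morphism
between connected anabelioids, then it follows that `V` is slim".
[cite: MochizukiGeoAn2004, Rem. 1.2.9.1 p.24] -/
def isSlim_target_of_isRelativelySlim : Prop :=
  ∀ (X : Type u₁) [Category.{v₁} X] (Y : Type u₂) [Category.{v₂} Y] [GaloisCategory X]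
    [GaloisCategory Y] (φ : Hom X Y), IsRelativelySlim φ.pullback → IsSlim Y

/-- NAMED FACT, [GeoAn] Remark 1.2.9.1, fourth assertion: "if, moreover, `U → V` is a
`π₁`-monomorphism, then it follows that `U` is also slim". [cite: MochizukiGeoAn2004, Rem. 1.2.9.1 p.24] -/
def isSlim_source_of_isRelativelySlim_of_isPi1Mono : Prop :=
  ∀ (X : Type u₁) [Category.{v₁} X] (Y : Type u₂) [Category.{v₂} Y] [GaloisCategory X]
    [GaloisCategory Y] (φ : Hom X Y), IsRelativelySlim φ.pullback → IsPi1Mono φ.pullback → IsSlim X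

/-- NAMED FACT ([SemiAnbd] §0 p. 6; [GeoAn] Cor. 1.1.6 + Def. 1.2.4): "`B(G)` is slim [as a
category: every `B(G)_A → B(G)` is a rigid functor] if and only if, for every open subgroup
`H ⊆ G`, we have `Z_G(H) = {1}`", `G` profinite. [cite: MochizukiSemiAnbd2006, §0 p.6] -/
def bCat_isSlim_iff_isSlimGroup : Prop :=
  ∀ (G : Type) [Group G] [TopologicalSpace G] [IsTopologicalGroup G] [CompactSpace G]
    [T2Space G] [TotallyDisconnectedSpace G],
    Literature.AlgebraicGeometry.Frobenioids.IsSlim (BCat G) ↔ IsSlimGroup G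

end Slim

end Literature.AnabelianGeometry.Anabelioids
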